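import Literature.NumberTheory.GelbartRogawski1991.Prop311PrintedCarriers
import Literature.NumberTheory.GelbartRogawski1991.Prop311ModelIndependence
import HarnessLib

/-!
# [GelbartRogawski1991, Prop. 3.1.1] AS PRINTED: the degenerate model `S = 0`

Topic `NumberTheory/GelbartRogawski1991`; namespace `Literature.NumberTheory.GelbartRogawski1991.Prop311`.  KERNEL ONLY:
theorems; no definition, no named fact, no `sorry`; `Prop311AsPrinted` is untouched.

The binders "`ρ_ψ` an irreducible unitary representation of `H_𝐀(W)` with central character `ψ`" of `Prop311AsPrinted`
(`S ρ _hρu _hρc _hρi _hρz`, [GelbartRogawski1991, §3.1 p. 454 L19–21] as rendered) are also inhabited by the ZERO Hilbert space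
`S` (every hypothesis is then vacuous), which print tacitly excludes ("irreducible" representations live on non-zero spaces)
but the statement-exact typing does not.  For a complete proof of the body of `Prop311AsPrinted` at CM data this degenerate
model must therefore be covered separately — `Prop311RhoPsiUnique.rho_unique` and `Prop311ModelIndependence.conclusion_of_conclusion`
ask `[Nontrivial S]`.  Here: for `S` a subsingleton, print's `Mp_𝐀(W)` over `ρ` is ALL of `Sp_𝐀(W) × GL(S)` (`GL(S)` a point), so
`g ↦ (ι g, 1)` is a continuous homomorphic section over `G(𝐀)` carrying `G(F)` into `i(Sp_F(W))` for ANY rational splitting `i`: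
**`conclusion_of_subsingleton`** — clauses (1) ∧ (2) of Prop. 3.1.1, verbatim as rendered in `Prop311AsPrinted`, for every
`(F, E, V, Φ)`, every subsingleton model and every rational splitting.

## References
* [GelbartRogawski1991] S. Gelbart, J. Rogawski, Invent. Math. 105 (1991) 445–472, §3.1 p. 454 L17–42, Prop. 3.1.1 p. 455 L1–2.
* [MoeglinVignerasWaldspurger1987] C. Mœglin, M.-F. Vignéras, J.-L. Waldspurger, LNM 1291 (1987), Chap. 2 II.1.
-/

set_option autoImplicit false

noncomputable section

open NumberField
open scoped TensorProduct
open Literature.RepresentationTheory.HeisenbergGroup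

namespace Literature.NumberTheory.GelbartRogawski1991

namespace Prop311

variable (F : Type) [Field F] [NumberField F]
variable (E : Type) [Field E] [Algebra F E]
variable (V : Type) [AddCommGroup V] [Module F V] [Module E V] [IsScalarTower F E V]
variable (Φ : V →ₗ[F] V →ₗ[F] E)
variable {S : Type} [NormedAddCommGroup S] [InnerProductSpace ℂ S] [Subsingleton S]
variable (ρ : Representation ℂ (AdelicHeisenberg F E V Φ) S)

omit [Module E V] [IsScalarTower F E V] in
/-- over a subsingleton model every pair `(g, M)` is a bounded pair of print's `Mp_𝐀(W)`: `Mp_𝐀(W) = Sp_𝐀(W) × GL(S)`.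
[cite: GelbartRogawski1991, §3.1 p. 454 L21–24; MoeglinVignerasWaldspurger1987, Chap. 2 II.1 (A)] -/
theorem mem_adelicMp_of_subsingleton (p : adelicSp F E V Φ × (S ≃ₗ[ℂ] S)) : p ∈ adelicMp F E V Φ ρ := by
  refine Subgroup.mem_inf.2 ⟨(mem_MpPsi ρ p).2 fun _ _ => Subsingleton.elim _ _, Subgroup.mem_comap.2 ⟨?_, ?_⟩⟩
  · exact (continuous_const (y := (0 : S))).congr fun _ => Subsingleton.elim _ _
  · exact (continuous_const (y := (0 : S))).congr fun _ => Subsingleton.elim _ _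

omit [NumberField F] [Module E V] [IsScalarTower F E V] in
/-- `GL(S)` is a point for a subsingleton `S`. [cite: GelbartRogawski1991, §3.1 p. 454 L23] -/
theorem linearEquiv_eq_of_subsingleton (M N : S ≃ₗ[ℂ] S) : M = N :=
  LinearEquiv.ext fun _ => Subsingleton.elim _ _

/-- **the degenerate model**: for `S` a subsingleton, clauses (1) ∧ (2) of [GelbartRogawski1991, Prop. 3.1.1], verbatim as
rendered in `Prop311AsPrinted`, hold for `ρ` on `S` and ANY rational splitting `i` — the section is `g ↦ (ι g, 1)`
(`ι : G(𝐀) → Sp_𝐀(W)` the inclusion `adelicUnitaryToSp`), continuous since its `Sp`-coordinates are the coordinates of `G(𝐀)`,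
and on `G(F)` it agrees with `i ∘ (G(F) → Sp_F(W))` because a pair is determined by its `Sp`-component.
[cite: GelbartRogawski1991, Prop. 3.1.1 p. 455 L1–2; §3.1 p. 454 L35–42] -/
theorem conclusion_of_subsingleton (i : ratSp F E V Φ →* adelicMp F E V Φ ρ) (hi : IsRationalSplitting F E V Φ ρ i) :
    (∃ s : adelicUnitary F E V Φ →* adelicMp F E V Φ ρ,
        ∀ g : adelicUnitary F E V Φ, projEnd F E V Φ ρ (s g) =
          ((g : AdelicSpace F V ≃ₗ[AdeleRing (𝓞 F) F] AdelicSpace F V) :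
            AdelicSpace F V →ₗ[AdeleRing (𝓞 F) F] AdelicSpace F V)) ∧
      ∃ s : adelicUnitary F E V Φ →* adelicMp F E V Φ ρ,
        Continuous s ∧
        (∀ g : adelicUnitary F E V Φ, projEnd F E V Φ ρ (s g) =
          ((g : AdelicSpace F V ≃ₗ[AdeleRing (𝓞 F) F] AdelicSpace F V) :
            AdelicSpace F V →ₗ[AdeleRing (𝓞 F) F] AdelicSpace F V)) ∧
        ∀ g : adelicUnitary F E V Φ,
          IsRationalPoint F E V Φ (g : AdelicSpace F V ≃ₗ[AdeleRing (𝓞 F) F] AdelicSpace F V) → s g ∈ i.range := by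
  -- the section `g ↦ (ι g, 1)`
  let s : adelicUnitary F E V Φ →* adelicMp F E V Φ ρ :=
    ((adelicUnitaryToSp F E V Φ).prod 1).codRestrict (adelicMp F E V Φ ρ)
      fun g => mem_adelicMp_of_subsingleton F E V Φ ρ _
  have hs : ∀ g : adelicUnitary F E V Φ, projEnd F E V Φ ρ (s g) =
      ((g : AdelicSpace F V ≃ₗ[AdeleRing (𝓞 F) F] AdelicSpace F V) :
        AdelicSpace F V →ₗ[AdeleRing (𝓞 F) F] AdelicSpace F V) := fun g => rfl
  have hsc : Continuous s := by
    refine continuous_to_adelicMp F E V Φ ρ (fun w => ?_) (fun f => ?_)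
    · exact continuous_adelicUnitaryToSp_apply F E V Φ w
    · exact (continuous_const (y := (0 : S))).congr fun _ => Subsingleton.elim _ _
  refine ⟨⟨s, hs⟩, s, hsc, hs, fun g hg => ?_⟩
  -- rational points: `g = 1 ⊗ g₀`, and `s g = i (g₀|_F)` since both lie over `1 ⊗ g₀|_F` and `GL(S)` is a point
  obtain ⟨g₀, rfl⟩ := (mem_range_ratUnitaryToAdelic_iff F E V Φ g).2 hg
  refine MonoidHom.mem_range.2 ⟨ratUnitaryToRatSp F E V Φ g₀, Subtype.ext (Prod.ext (Subtype.ext ?_) ?_)⟩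
  · apply LinearEquiv.toLinearMap_injective
    have h1 := hi (ratUnitaryToRatSp F E V Φ g₀)
    have h2 := hs (ratUnitaryToAdelic F E V Φ g₀)
    rw [projEnd] at h1 h2
    rw [coe_coe_ratUnitaryToAdelic] at h2
    exact h1.trans h2.symm
  · exact linearEquiv_eq_of_subsingleton _ _

end Prop311

end Literature.NumberTheory.GelbartRogawski1991

end
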